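import Summits.Ventures.PercRepro.HyperplaneKeyBasesNine

/-!
# PercRepro — THE UPWARD KEY: `RLS M p q` ON THE `e`-FREE CORE FROM `n ≥ f(q) + (q+1)·Φ(p,q)`, AT EVERY LEVEL (p1, gen 44; an
S3 / S4 feeder — p8 owns SUBCLAIM-S3, p9 SUBCLAIM-S4; no window claim here)

THE STEP (`upward_step`): every rank-`q` set `X` has at least `n − f(q)` one-point extensions `X ∪ {x}` with `x ∉ cl X` (its
closure is a rank-`q` set, of `≤ f(q)` points), each of rank `q + 1`; a rank-`(q+1)` set `Z` arises from at most `q + 1` such pairs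
(the points `x ∈ Z` with `x ∉ cl(Z ∖ {x})` form an independent set, `coloops_indep`). Hence
`(n − f(q))·#{ρ = q} ≤ (q+1)·#{ρ = q+1}`. With `#U ≤ #{ρ = q}` (the complement of a top set, `topCount_le_rank_eq`) and
`#{ρ = q+1} ≤ #Y(p,q)` for `q + 1 < p`: **`Φ(p,q)·#U ≤ #Y` as soon as `(q+1)·Φ(p,q) ≤ n − f(q)`** (`rls_of_upward_key`). TWO LAYERS
(`rls_of_upward_key_two`): `#Y ≥ #{ρ = q+1} + #{ρ = q+2}` and the step once more, so `(q+1)(q+2)·Φ ≤ (n − f(q))·(q + 2 + n − f(q+1))`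
suffices when `q + 2 < p` and `n ≥ f(q+1)`. No hypothesis on the rank of `M`, uniform in `n` and `p` (the threshold is a formula in
`Φ(p,q)`); the flat bounds are the cell's `f(5 … 9) = 19, 39, 79, 159, 319` and, at EVERY level, `f(q) ≤ 2^q − 1` (`c025_core_upward_key_all`).

WHERE IT STANDS (exact rationals, tools/price_upward.py; `n₀` = the least `n` of the key): level `7`, one layer: `99 / 114 / 133 / 159`
at `p = 10 / 11 / 12 / 13`, two layers: `163 / 168 / 174 / 182` at `14 … 17` — against the sharpened hyperplane keys `182 … 192`: the
tail of record for the rows `10 … 17` (`d₀ = 89 / 103 / 121 / 146 / 149 / 153 / 158 / 165`). Level `8`: one layer `169 / 181 / 197 / 217 / 244 /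
281` at `10 … 15`, two layers `320 / 325 / 330 / 338 / 349 / 363` at `16 … 21` — against the ladder's `346 … 368`: the tail of record for
the rows `10 … 21`. Level `9`: `330 / 343 / …` from `p = 11` against `666 …`. Beyond those rows `Φ` is too large (it doubles per row) and
the hyperplane / size keys take over. Coloops are not excluded; nothing is claimed below the thresholds.
Axioms: standard.
-/

open scoped Matroid

namespace PercRepro

namespace HypKey

open Set

variable {α : Type}

/-- **`#U(p, q) ≤ #{ρ = q}`**: the complement of a top set is a rank-`q` set; `A ↦ E ∖ A` is injective on subsets of `E`. -/
theorem topCount_le_rank_eq (M : Matroid α) [M.Finite] (p q : ℕ) :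
    Matroid.topCount M p q ≤ {X : Set α | X ⊆ M.E ∧ M.eRk X = (q : ℕ∞)}.ncard := by
  unfold Matroid.topCount
  refine ncard_le_ncard_of_injOn (fun A => M.E \ A) ?_ ?_
    (M.ground_finite.finite_subsets.subset (fun X hX => hX.1))
  · rintro A ⟨-, -, hAc⟩
    exact ⟨sdiff_subset, hAc⟩
  · rintro A ⟨hA, -, -⟩ A' ⟨hA', -, -⟩ h
    simp only at h
    rw [← sdiff_sdiff_cancel_left hA, h, sdiff_sdiff_cancel_left hA']

/-- **The coloops of `Z` are independent**: `{x ∈ Z : x ∉ cl(Z ∖ {x})}` is independent, so it has at most `ρ(Z)` points. -/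
theorem encard_coloops_le_eRk (M : Matroid α) (Z : Set α) (hZ : Z ⊆ M.E) :
    {x ∈ Z | x ∉ M.closure (Z \ {x})}.encard ≤ M.eRk Z := by
  set C : Set α := {x ∈ Z | x ∉ M.closure (Z \ {x})} with hC
  have hCZ : C ⊆ Z := fun x hx => hx.1
  have hCE : C ⊆ M.E := hCZ.trans hZ
  have hind : M.Indep C := by
    rw [Matroid.indep_iff_forall_notMem_closure_sdiff hCE]
    intro e he hecl
    have hsub : C \ {e} ⊆ Z \ {e} := Set.sdiff_subset_sdiff_left hCZ
    exact he.2 (M.closure_subset_closure hsub hecl)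
  exact hind.encard_le_eRk_of_subset hCZ

/-- **THE UPWARD STEP.** If every set of rank `≤ q` has `≤ F` points then
`(n − F)·#{X ⊆ E : ρ(X) = q} ≤ (q + 1)·#{Z ⊆ E : ρ(Z) = q + 1}`. -/
theorem upward_step (M : Matroid α) [M.Finite] (q F : ℕ)
    (hflat : ∀ X ⊆ M.E, M.eRk X ≤ (q : ℕ∞) → X.ncard ≤ F) :
    (M.E.ncard - F) * {X : Set α | X ⊆ M.E ∧ M.eRk X = (q : ℕ∞)}.ncard ≤
      (q + 1) * {Z : Set α | Z ⊆ M.E ∧ M.eRk Z = ((q + 1 : ℕ) : ℕ∞)}.ncard := by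
  classical
  have hfinX : {X : Set α | X ⊆ M.E ∧ M.eRk X = (q : ℕ∞)}.Finite :=
    M.ground_finite.finite_subsets.subset (fun X hX => hX.1)
  have hfinZ : {Z : Set α | Z ⊆ M.E ∧ M.eRk Z = ((q + 1 : ℕ) : ℕ∞)}.Finite :=
    M.ground_finite.finite_subsets.subset (fun X hX => hX.1)
  set 𝒳 : Finset (Set α) := hfinX.toFinset with h𝒳
  set 𝒵 : Finset (Set α) := hfinZ.toFinset with h𝒵
  have hmemX : ∀ X, X ∈ 𝒳 ↔ X ⊆ M.E ∧ M.eRk X = (q : ℕ∞) := fun X => by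
    rw [h𝒳, Set.Finite.mem_toFinset]; rfl
  have hmemZ : ∀ Z, Z ∈ 𝒵 ↔ Z ⊆ M.E ∧ M.eRk Z = ((q + 1 : ℕ) : ℕ∞) := fun Z => by
    rw [h𝒵, Set.Finite.mem_toFinset]; rfl
  -- the extensions of `X`: the finset of `x ∈ E ∖ cl X`
  set ext : Set α → Finset α := fun X => (M.ground_finite.subset (Set.sdiff_subset (t := M.closure X))).toFinset with hext
  have hmemext : ∀ X x, x ∈ ext X ↔ x ∈ M.E ∧ x ∉ M.closure X := fun X x => by
    rw [hext]
    simp only [Set.Finite.mem_toFinset, Set.mem_sdiff]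
  -- each rank-`q` set has `≥ n − F` extensions
  have hextcard : ∀ X ∈ 𝒳, M.E.ncard - F ≤ (ext X).card := by
    intro X hX
    obtain ⟨hXE, hXr⟩ := (hmemX X).1 hX
    have hcl : (M.closure X).ncard ≤ F := by
      refine hflat _ (M.closure_subset_ground X) ?_
      rw [M.eRk_closure_eq, hXr]
    have hcard : (ext X).card = (M.E \ M.closure X).ncard := by
      rw [hext]
      exact (Set.ncard_eq_toFinset_card _ _).symm
    rw [hcard, Set.ncard_sdiff (M.closure_subset_ground X) (M.ground_finite.subset (M.closure_subset_ground X))]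
    omega
  set P : Finset (Σ _ : Set α, α) := 𝒳.sigma ext with hP
  have hPcard : (M.E.ncard - F) * 𝒳.card ≤ P.card := by
    rw [hP, Finset.card_sigma, mul_comm]
    have := Finset.card_nsmul_le_sum 𝒳 (fun X => (ext X).card) (M.E.ncard - F) hextcard
    simpa [smul_eq_mul] using this
  have hmemP : ∀ a ∈ P, a.1 ∈ 𝒳 ∧ a.2 ∈ M.E ∧ a.2 ∉ M.closure a.1 := by
    rintro ⟨X, x⟩ haP
    rw [hP, Finset.mem_sigma] at haP
    obtain ⟨h1, h2⟩ := haP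
    rw [hmemext] at h2
    exact ⟨h1, h2.1, h2.2⟩
  -- the pairs map to rank-`(q+1)` sets
  have hmaps : ∀ a ∈ P, insert a.2 a.1 ∈ 𝒵 := by
    rintro ⟨X, x⟩ haP
    obtain ⟨hX, hxE, hxcl⟩ := hmemP ⟨X, x⟩ haP
    simp only at hX hxE hxcl
    obtain ⟨hXE, hXr⟩ := (hmemX X).1 hX
    rw [hmemZ]
    refine ⟨Set.insert_subset hxE hXE, ?_⟩
    rw [Matroid.eRk_insert_eq_add_one ⟨hxE, hxcl⟩, hXr]
    push_cast
    rfl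
  -- the fibre over `Z` injects into the coloops of `Z`
  have hfib : ∀ Z ∈ 𝒵, (P.filter (fun a => insert a.2 a.1 = Z)).card ≤ q + 1 := by
    intro Z hZ
    obtain ⟨hZE, hZr⟩ := (hmemZ Z).1 hZ
    have hZfin : Z.Finite := M.ground_finite.subset hZE
    have hCfin : {x ∈ Z | x ∉ M.closure (Z \ {x})}.Finite := hZfin.subset (fun x hx => hx.1)
    have hC : hCfin.toFinset.card ≤ q + 1 := by
      have h1 := encard_coloops_le_eRk M Z hZE
      rw [hZr, ← hCfin.cast_ncard_eq] at h1
      have h2 : {x ∈ Z | x ∉ M.closure (Z \ {x})}.ncard ≤ q + 1 := by exact_mod_cast h1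
      rw [Set.ncard_eq_toFinset_card _ hCfin] at h2
      exact h2
    refine le_trans (Finset.card_le_card_of_injOn (fun a => a.2) ?_ ?_) hC
    · rintro ⟨X, x⟩ ha
      rw [Finset.mem_coe, Finset.mem_filter] at ha
      obtain ⟨-, hxE, hxcl⟩ := hmemP _ ha.1
      simp only at hxcl ha
      have hxX : x ∉ X := fun h => hxcl (M.mem_closure_of_mem h ((hmemX X).1 (hmemP _ ha.1).1).1)
      have hXeq : X = Z \ {x} := by
        rw [← ha.2, Set.insert_sdiff_self_of_notMem hxX]
      rw [Finset.mem_coe, Set.Finite.mem_toFinset]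
      refine ⟨by rw [← ha.2]; exact Set.mem_insert _ _, ?_⟩
      rw [← hXeq]
      exact hxcl
    · rintro ⟨X, x⟩ ha ⟨X', x'⟩ ha' hxx'
      simp only at hxx'
      subst hxx'
      rw [Finset.mem_coe, Finset.mem_filter] at ha ha'
      obtain ⟨hX, -, hxcl⟩ := hmemP _ ha.1
      obtain ⟨hX', -, hxcl'⟩ := hmemP _ ha'.1
      simp only at hX hxcl hX' hxcl' ha ha'
      have hxX : x ∉ X := fun h => hxcl (M.mem_closure_of_mem h ((hmemX X).1 hX).1)
      have hxX' : x ∉ X' := fun h => hxcl' (M.mem_closure_of_mem h ((hmemX X').1 hX').1)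
      have hXX' : X = X' := by
        rw [← Set.insert_sdiff_self_of_notMem hxX, ← Set.insert_sdiff_self_of_notMem hxX', ha.2, ha'.2]
      subst hXX'
      rfl
  have hmain := Finset.card_le_mul_card_image_of_maps_to hmaps (q + 1) hfib
  have hXcard : 𝒳.card = {X : Set α | X ⊆ M.E ∧ M.eRk X = (q : ℕ∞)}.ncard := by
    rw [h𝒳]; exact (Set.ncard_eq_toFinset_card _ hfinX).symm
  have hZcard : 𝒵.card = {Z : Set α | Z ⊆ M.E ∧ M.eRk Z = ((q + 1 : ℕ) : ℕ∞)}.ncard := by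
    rw [h𝒵]; exact (Set.ncard_eq_toFinset_card _ hfinZ).symm
  rw [← hXcard, ← hZcard]
  exact hPcard.trans hmain

/-- **`#{ρ = q + 1} ≤ #Y(p, q)`** for `q + 1 < p`. -/
theorem ncard_rank_eq_succ_le_midCount (M : Matroid α) [M.Finite] (p q : ℕ) (hqp : q + 1 < p) :
    {Z : Set α | Z ⊆ M.E ∧ M.eRk Z = ((q + 1 : ℕ) : ℕ∞)}.ncard ≤ Matroid.midCount M p q := by
  unfold Matroid.midCount
  refine Set.ncard_le_ncard ?_ (M.ground_finite.finite_subsets.subset (fun X hX => hX.1))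
  rintro Z ⟨hZE, hZr⟩
  refine ⟨hZE, ?_, ?_⟩
  · rw [hZr]; exact_mod_cast Nat.lt_succ_self q
  · rw [hZr]; exact_mod_cast hqp

/-- **`#{ρ = q + 1} + #{ρ = q + 2} ≤ #Y(p, q)`** for `q + 2 < p`. -/
theorem ncard_rank_eq_succ_add_le_midCount (M : Matroid α) [M.Finite] (p q : ℕ) (hqp : q + 2 < p) :
    {Z : Set α | Z ⊆ M.E ∧ M.eRk Z = ((q + 1 : ℕ) : ℕ∞)}.ncard +
      {Z : Set α | Z ⊆ M.E ∧ M.eRk Z = ((q + 2 : ℕ) : ℕ∞)}.ncard ≤ Matroid.midCount M p q := by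
  have hfin1 : {Z : Set α | Z ⊆ M.E ∧ M.eRk Z = ((q + 1 : ℕ) : ℕ∞)}.Finite :=
    M.ground_finite.finite_subsets.subset (fun X hX => hX.1)
  have hfin2 : {Z : Set α | Z ⊆ M.E ∧ M.eRk Z = ((q + 2 : ℕ) : ℕ∞)}.Finite :=
    M.ground_finite.finite_subsets.subset (fun X hX => hX.1)
  have hdisj : Disjoint {Z : Set α | Z ⊆ M.E ∧ M.eRk Z = ((q + 1 : ℕ) : ℕ∞)}
      {Z : Set α | Z ⊆ M.E ∧ M.eRk Z = ((q + 2 : ℕ) : ℕ∞)} := by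
    rw [Set.disjoint_left]
    rintro Z ⟨-, h1⟩ ⟨-, h2⟩
    rw [h1] at h2
    have : q + 1 = q + 2 := by exact_mod_cast h2
    omega
  rw [← Set.ncard_union_eq hdisj hfin1 hfin2]
  unfold Matroid.midCount
  refine Set.ncard_le_ncard ?_ (M.ground_finite.finite_subsets.subset (fun X hX => hX.1))
  rintro Z (⟨hZE, hZr⟩ | ⟨hZE, hZr⟩)
  · refine ⟨hZE, ?_, ?_⟩
    · rw [hZr]; exact_mod_cast Nat.lt_succ_self q
    · rw [hZr]; exact_mod_cast (by omega : q + 1 < p)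
  · refine ⟨hZE, ?_, ?_⟩
    · rw [hZr]; exact_mod_cast (by omega : q < q + 2)
    · rw [hZr]; exact_mod_cast hqp

/-- **THE UPWARD KEY (one layer).** Rank-`≤ q` sets of `≤ F` points, `q + 1 < p`, `F ≤ n` and `(q + 1)·Φ(p, q) ≤ n − F` give
`ThmN.RLS M p q` (no hypothesis on the rank of `M`). -/
theorem rls_of_upward_key (M : Matroid α) [M.Finite] (p q F : ℕ)
    (hflat : ∀ X ⊆ M.E, M.eRk X ≤ (q : ℕ∞) → X.ncard ≤ F) (hqp : q + 1 < p) (hF : F ≤ M.E.ncard)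
    (hkey : ((q + 1 : ℕ) : ℚ) * phiK p q ≤ (M.E.ncard : ℚ) - (F : ℚ)) : ThmN.RLS M p q := by
  rw [ThmN.RLS_iff]
  have hΦ := phiK_nonneg p q
  have hU := topCount_le_rank_eq M p q
  have hstep := upward_step M q F hflat
  have hY := ncard_rank_eq_succ_le_midCount M p q hqp
  have hUq : (Matroid.topCount M p q : ℚ) ≤ ({X : Set α | X ⊆ M.E ∧ M.eRk X = (q : ℕ∞)}.ncard : ℚ) := by
    exact_mod_cast hU
  have hYq : ({Z : Set α | Z ⊆ M.E ∧ M.eRk Z = ((q + 1 : ℕ) : ℕ∞)}.ncard : ℚ) ≤ (Matroid.midCount M p q : ℚ) := by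
    exact_mod_cast hY
  have hstepq : ((M.E.ncard : ℚ) - (F : ℚ)) * ({X : Set α | X ⊆ M.E ∧ M.eRk X = (q : ℕ∞)}.ncard : ℚ) ≤
      ((q + 1 : ℕ) : ℚ) * ({Z : Set α | Z ⊆ M.E ∧ M.eRk Z = ((q + 1 : ℕ) : ℕ∞)}.ncard : ℚ) := by
    have h1 : (((M.E.ncard - F) * {X : Set α | X ⊆ M.E ∧ M.eRk X = (q : ℕ∞)}.ncard : ℕ) : ℚ) ≤
        (((q + 1) * {Z : Set α | Z ⊆ M.E ∧ M.eRk Z = ((q + 1 : ℕ) : ℕ∞)}.ncard : ℕ) : ℚ) := by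
      exact_mod_cast hstep
    push_cast [Nat.cast_sub hF] at h1 ⊢
    exact h1
  generalize ha : ({X : Set α | X ⊆ M.E ∧ M.eRk X = (q : ℕ∞)}.ncard : ℚ) = a at hUq hstepq
  generalize hb : ({Z : Set α | Z ⊆ M.E ∧ M.eRk Z = ((q + 1 : ℕ) : ℕ∞)}.ncard : ℚ) = b at hYq hstepq
  have ha0 : 0 ≤ a := by rw [← ha]; exact Nat.cast_nonneg _
  have hq1 : (0 : ℚ) < ((q + 1 : ℕ) : ℚ) := by positivity
  have hΦa : phiK p q * a ≤ b := by
    have h2 : ((q + 1 : ℕ) : ℚ) * (phiK p q * a) ≤ ((q + 1 : ℕ) : ℚ) * b := by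
      calc ((q + 1 : ℕ) : ℚ) * (phiK p q * a) = (((q + 1 : ℕ) : ℚ) * phiK p q) * a := by ring
        _ ≤ ((M.E.ncard : ℚ) - (F : ℚ)) * a := mul_le_mul_of_nonneg_right hkey ha0
        _ ≤ ((q + 1 : ℕ) : ℚ) * b := hstepq
    exact le_of_mul_le_mul_left h2 hq1
  calc phiK p q * (Matroid.topCount M p q : ℚ) ≤ phiK p q * a := mul_le_mul_of_nonneg_left hUq hΦ
    _ ≤ b := hΦa
    _ ≤ (Matroid.midCount M p q : ℚ) := hYq

/-- **THE UPWARD KEY (two layers).** Rank-`≤ q` sets of `≤ F` points, rank-`≤ q+1` sets of `≤ F'` points, `q + 2 < p`,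
`F ≤ n`, `F' ≤ n` and `(q+1)(q+2)·Φ(p,q) ≤ (n − F)·(q + 2 + (n − F'))` give `ThmN.RLS M p q`. -/
theorem rls_of_upward_key_two (M : Matroid α) [M.Finite] (p q F F' : ℕ)
    (hflat : ∀ X ⊆ M.E, M.eRk X ≤ (q : ℕ∞) → X.ncard ≤ F)
    (hflat' : ∀ X ⊆ M.E, M.eRk X ≤ ((q + 1 : ℕ) : ℕ∞) → X.ncard ≤ F') (hqp : q + 2 < p)
    (hF : F ≤ M.E.ncard) (hF' : F' ≤ M.E.ncard)
    (hkey : ((q + 1 : ℕ) : ℚ) * ((q + 2 : ℕ) : ℚ) * phiK p q ≤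
      ((M.E.ncard : ℚ) - (F : ℚ)) * (((q + 2 : ℕ) : ℚ) + ((M.E.ncard : ℚ) - (F' : ℚ)))) : ThmN.RLS M p q := by
  rw [ThmN.RLS_iff]
  have hΦ := phiK_nonneg p q
  have hU := topCount_le_rank_eq M p q
  have hstep := upward_step M q F hflat
  have hstep' := upward_step M (q + 1) F' hflat'
  have hY := ncard_rank_eq_succ_add_le_midCount M p q hqp
  have hUq : (Matroid.topCount M p q : ℚ) ≤ ({X : Set α | X ⊆ M.E ∧ M.eRk X = (q : ℕ∞)}.ncard : ℚ) := by
    exact_mod_cast hU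
  have hYq : ({Z : Set α | Z ⊆ M.E ∧ M.eRk Z = ((q + 1 : ℕ) : ℕ∞)}.ncard : ℚ) +
      ({Z : Set α | Z ⊆ M.E ∧ M.eRk Z = ((q + 1 + 1 : ℕ) : ℕ∞)}.ncard : ℚ) ≤ (Matroid.midCount M p q : ℚ) := by
    have e : {Z : Set α | Z ⊆ M.E ∧ M.eRk Z = ((q + 2 : ℕ) : ℕ∞)} =
        {Z : Set α | Z ⊆ M.E ∧ M.eRk Z = ((q + 1 + 1 : ℕ) : ℕ∞)} := rfl
    rw [e] at hY
    exact_mod_cast hY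
  have hstepq : ((M.E.ncard : ℚ) - (F : ℚ)) * ({X : Set α | X ⊆ M.E ∧ M.eRk X = (q : ℕ∞)}.ncard : ℚ) ≤
      ((q + 1 : ℕ) : ℚ) * ({Z : Set α | Z ⊆ M.E ∧ M.eRk Z = ((q + 1 : ℕ) : ℕ∞)}.ncard : ℚ) := by
    have h1 : (((M.E.ncard - F) * {X : Set α | X ⊆ M.E ∧ M.eRk X = (q : ℕ∞)}.ncard : ℕ) : ℚ) ≤
        (((q + 1) * {Z : Set α | Z ⊆ M.E ∧ M.eRk Z = ((q + 1 : ℕ) : ℕ∞)}.ncard : ℕ) : ℚ) := by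
      exact_mod_cast hstep
    push_cast [Nat.cast_sub hF] at h1 ⊢
    exact h1
  have hstepq' : ((M.E.ncard : ℚ) - (F' : ℚ)) * ({Z : Set α | Z ⊆ M.E ∧ M.eRk Z = ((q + 1 : ℕ) : ℕ∞)}.ncard : ℚ) ≤
      ((q + 2 : ℕ) : ℚ) * ({Z : Set α | Z ⊆ M.E ∧ M.eRk Z = ((q + 1 + 1 : ℕ) : ℕ∞)}.ncard : ℚ) := by
    have h1 : (((M.E.ncard - F') * {Z : Set α | Z ⊆ M.E ∧ M.eRk Z = ((q + 1 : ℕ) : ℕ∞)}.ncard : ℕ) : ℚ) ≤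
        (((q + 1 + 1) * {Z : Set α | Z ⊆ M.E ∧ M.eRk Z = ((q + 1 + 1 : ℕ) : ℕ∞)}.ncard : ℕ) : ℚ) := by
      exact_mod_cast hstep'
    push_cast [Nat.cast_sub hF'] at h1 ⊢
    have e : (q : ℚ) + 2 = (q : ℚ) + 1 + 1 := by ring
    rw [e]
    exact h1
  generalize ha : ({X : Set α | X ⊆ M.E ∧ M.eRk X = (q : ℕ∞)}.ncard : ℚ) = a at hUq hstepq
  generalize hb : ({Z : Set α | Z ⊆ M.E ∧ M.eRk Z = ((q + 1 : ℕ) : ℕ∞)}.ncard : ℚ) = b at hYq hstepq hstepq'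
  generalize hc : ({Z : Set α | Z ⊆ M.E ∧ M.eRk Z = ((q + 1 + 1 : ℕ) : ℕ∞)}.ncard : ℚ) = c at hYq hstepq'
  have ha0 : 0 ≤ a := by rw [← ha]; exact Nat.cast_nonneg _
  have hq1 : (0 : ℚ) < ((q + 1 : ℕ) : ℚ) := by positivity
  have hq2 : (0 : ℚ) < ((q + 2 : ℕ) : ℚ) := by positivity
  have hnF' : (0 : ℚ) ≤ (M.E.ncard : ℚ) - (F' : ℚ) := by
    have : (F' : ℚ) ≤ (M.E.ncard : ℚ) := by exact_mod_cast hF'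
    linarith
  have hmain : ((q + 1 : ℕ) : ℚ) * ((q + 2 : ℕ) : ℚ) * (phiK p q * a) ≤
      ((q + 1 : ℕ) : ℚ) * ((q + 2 : ℕ) : ℚ) * (b + c) := by
    have h3 : ((q + 2 : ℕ) : ℚ) * (((M.E.ncard : ℚ) - (F : ℚ)) * a) ≤ ((q + 1 : ℕ) : ℚ) * ((q + 2 : ℕ) : ℚ) * b := by
      calc ((q + 2 : ℕ) : ℚ) * (((M.E.ncard : ℚ) - (F : ℚ)) * a) ≤ ((q + 2 : ℕ) : ℚ) * (((q + 1 : ℕ) : ℚ) * b) :=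
            mul_le_mul_of_nonneg_left hstepq hq2.le
        _ = ((q + 1 : ℕ) : ℚ) * ((q + 2 : ℕ) : ℚ) * b := by ring
    have h4 : ((M.E.ncard : ℚ) - (F' : ℚ)) * (((M.E.ncard : ℚ) - (F : ℚ)) * a) ≤
        ((q + 1 : ℕ) : ℚ) * ((q + 2 : ℕ) : ℚ) * c := by
      calc ((M.E.ncard : ℚ) - (F' : ℚ)) * (((M.E.ncard : ℚ) - (F : ℚ)) * a)
          ≤ ((M.E.ncard : ℚ) - (F' : ℚ)) * (((q + 1 : ℕ) : ℚ) * b) := mul_le_mul_of_nonneg_left hstepq hnF'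
        _ = ((q + 1 : ℕ) : ℚ) * (((M.E.ncard : ℚ) - (F' : ℚ)) * b) := by ring
        _ ≤ ((q + 1 : ℕ) : ℚ) * (((q + 2 : ℕ) : ℚ) * c) := mul_le_mul_of_nonneg_left hstepq' hq1.le
        _ = ((q + 1 : ℕ) : ℚ) * ((q + 2 : ℕ) : ℚ) * c := by ring
    calc ((q + 1 : ℕ) : ℚ) * ((q + 2 : ℕ) : ℚ) * (phiK p q * a)
        = (((q + 1 : ℕ) : ℚ) * ((q + 2 : ℕ) : ℚ) * phiK p q) * a := by ring
      _ ≤ (((M.E.ncard : ℚ) - (F : ℚ)) * (((q + 2 : ℕ) : ℚ) + ((M.E.ncard : ℚ) - (F' : ℚ)))) * a :=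
          mul_le_mul_of_nonneg_right hkey ha0
      _ = ((q + 2 : ℕ) : ℚ) * (((M.E.ncard : ℚ) - (F : ℚ)) * a) +
          ((M.E.ncard : ℚ) - (F' : ℚ)) * (((M.E.ncard : ℚ) - (F : ℚ)) * a) := by ring
      _ ≤ ((q + 1 : ℕ) : ℚ) * ((q + 2 : ℕ) : ℚ) * b + ((q + 1 : ℕ) : ℚ) * ((q + 2 : ℕ) : ℚ) * c :=
          add_le_add h3 h4
      _ = ((q + 1 : ℕ) : ℚ) * ((q + 2 : ℕ) : ℚ) * (b + c) := by ring
  have hΦa : phiK p q * a ≤ b + c := le_of_mul_le_mul_left hmain (by positivity)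
  calc phiK p q * (Matroid.topCount M p q : ℚ) ≤ phiK p q * a := mul_le_mul_of_nonneg_left hUq hΦ
    _ ≤ b + c := hΦa
    _ ≤ (Matroid.midCount M p q : ℚ) := hYq

end HypKey

end PercRepro
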